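/-
Copyright (c) 2026. Released under Apache 2.0 license as described in the file LICENSE.
Track B ∕ K2-LIT (cell `hodgecm-mathlib`, squad K2, ENGINE E1), crux h413 = `stmt-HodgeConjecture-24833`, route of record `HCCMUnconditional`.
Prover seat `hodgecm-mathlib-K2E3-p12` (g7).  Deal «P8 prep» (K2E1-plan (g5) 08:56:01Z, «=» 09:04:59Z), file G-c: the `𝔛`-system of one ball, packaged (abstract letters, finite test-function family).
-/
import Summits.HodgeConjecture.HodgeConjecture.Theorems.K2E1BLSystemAssembly      -- ★ G-b (this seat): `locallyFiniteType_of_index`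
import Mathlib.Topology.Algebra.Module.ContinuousLinearMap.PiProd
import HarnessLib

/-!
# K2·E1 — `K2E1BLXSystemPackage`: THE `𝔛`-SYSTEM OF ONE BALL AS A SINGLE HOLOMORPHIC OPERATOR EQUATION `A(z)(ψ, b) = c(z)` — FINITELY MANY HECKE CONDITIONS `T_iψ = ĥ_i(z)ψ`, THE
# CONSTANT-TERM CONDITION `P(ιψ) = φ₀α₁(z) + bα₂(z)` AND THE CUSPIDAL ORTHOGONALITY `Qψ = 0` — HOLOMORPHIC IN `z` AND LOCALLY OF FINITE TYPE WHEREVER SOME `ĥ_i ≠ 0`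
# [arXiv:1911.02342, §4 system `Ξ(s)` (p. 9) + Claim 5 and p. 10], OVER ABSTRACT LETTERS

Track B ∕ K2-LIT, crux h413 = `stmt-HodgeConjecture-24833`, route of record `HCCMUnconditional`; cell `hodgecm-mathlib`, squad K2, ENGINE E1 (campaign EIS-R7-BL-SPH-2, (ζ′) WIRING §3
P8 «P8 prep»; dealer rulings 09:00:48Z «the prep's value is the SYSTEM PACKAGING … as ONE holomorphic family `A z : V × ℂ →L[ℂ] W` (unknown = the PAIR (ψ, b))» and 09:04:59Z (D-i):
per ball a FINITE family `h_i` with `∀ z ∈ closedBall, ∃ i, ĥ_i z ≠ 0`).  Prover seat `hodgecm-mathlib-K2E3-p12` (g7).  THEOREMS ONLY (no `def`, no `instance`, no notation, no named-fact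
hypothesis, no `sorry`); lane `--supports stmt-HodgeConjecture-24833 --as helper` (count-neutral).  Closes no socket.  GENERIC — abstract letters (instantiation table in ★ G-b's docstring;
`T i := δ(η_i) ∘L δ(η_i)`, `ĥ i := η̂_i²` per the «h := η ∗ η» ruling 09:04:47Z).

THE MATHEMATICS [BernsteinLapid2019, §4].  B–L's system `Ξ(s)` (p. 9: (Ξ₁) `δ(h)ψ = ĥ(s)ψ ∀h`, (Ξ₂) constant term in `span{y^s, y^{1−s}}`, (Ξ₃) `ψ ⊥` cusp forms) lives on an LF-space
and is global in `s`; its Hilbert-space avatar is local (weight `N = 1 + sup_U |Re s|`, p. 10).  On ONE ball `D` we therefore pose, in the unknown PAIR `(ψ, b) ∈ X × ℂ` (`X = 𝓗_k(𝔛)`,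
`b` the coefficient of `H^{1−z}`): `T_iψ = ĥ_i(z)ψ` for a FINITE family `i ∈ I` of good test functions with no common zero of the `ĥ_i` on `D` (★ G-a `exists_finset_forall_exists_ne_zero`
+ ★ P5b), `P(ιψ) − bα₂(z) = φ₀α₁(z)` (Ξ₂ through `ι = ι_{c,k}`, `P = cnst_{k,c}`), `Qψ = 0` (Ξ₃).  This file PACKAGES these as one operator `A(z) : X × ℂ →L (I → X) × V × X'` with
right-hand side `c(z)`, proves `A`, `c` holomorphic on `D`, characterises the solutions, and — from the per-index `Z`-side letters of ★ G-b `locallyFiniteType_of_index` — proves the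
`hfin` clause of ★ `exists_meromorphic_solution` at EVERY point of `D`.  P8 proper then only supplies letters, existence (★ P7) and uniqueness (★ P6) on the Godement set, and calls ★ G-b
`exists_meromorphicOn_scalar_of_system` per ball and ★ G-a `exists_meromorphicOn_univ_of_balls`.
§1 `sum_smul_single` (coordinates of `Σ_i w_i • single_i ψ`).  §2 **`exists_xSystem`** — THE PACKAGE (existential in `A`, `c`; four clauses: holomorphy of `A`, of `c`, solution
characterisation, `hfin` on `D`).  §3 `xSystem_b_unique` (the `b`-component of a solution is determined by `ψ` when `α₂(z) ≠ 0`) and `xSystem_existsUnique_of` (uniqueness of `ψ` +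
`α₂(z) ≠ 0` + a solution ⟹ `∃!`), the two bookkeeping facts P8 proper needs for `hunq`.
HONEST LABEL: HC_CM is proved only modulo the 7 printed citations (2 remaining named inputs: hLiu418 = `stmt-HodgeConjecture-24832`, h413 = `stmt-HodgeConjecture-24833`) until rung 0
closes; this file asserts no named fact and closes no socket.
References: [BernsteinLapid2019] J. Bernstein, E. Lapid, *On the meromorphic continuation of Eisenstein series*, arXiv:1911.02342 (JAMS 37 (2024), doi:10.1090/jams/1020), §4 pp. 9–10.
-/

set_option autoImplicit false
-- the mandated namespace repeats the single-problem summit's segment (`HodgeConjecture.HodgeConjecture`)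
set_option linter.dupNamespace false

noncomputable section

open Filter Topology Set Submodule
open scoped Classical
open Summit.HodgeConjecture.HodgeConjecture.Cruxes.H413.K2E1BLSystemAssembly (locallyFiniteType_of_index)

namespace Summit.HodgeConjecture.HodgeConjecture.Cruxes.H413.K2E1BLXSystemPackage

/-! ## §1 Coordinates of a weighted sum of `Pi.single`s -/

/-- `(Σ_i w_i • single_i ψ)_j = w_j • ψ`. [folklore] -/
theorem sum_smul_single {I X : Type*} [Fintype I] [DecidableEq I] [AddCommMonoid X] [Module ℂ X] (w : I → ℂ) (ψ : X) :
    (∑ i, w i • (Pi.single i ψ : I → X)) = fun j => w j • ψ := by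
  funext j
  rw [Finset.sum_apply]
  simp only [Pi.smul_apply, Pi.single_apply, smul_ite, smul_zero, Finset.sum_ite_eq, Finset.mem_univ, if_true]

/-! ## §2 The package -/

/-- **THE `𝔛`-SYSTEM OF ONE BALL, PACKAGED** [BernsteinLapid2019, §4 system `Ξ(s)` p. 9, Claim 5 and p. 10].  Data: a finite index type `I`; normed `X` (`𝓗_k(𝔛)`), Hilbert `V` (`𝓗_k(Z_c)`),
normed `X'` and `V₀ i` (`𝓗_k(Z_{c₀,i})`); `T i : X →L X`, `ĥ i` holomorphic on the open `D` with `∀ z ∈ D, ∃ i, ĥ i z ≠ 0`; `ι : X →L V`, `P : V →L V`, `Q : X →L X'`; `α₁ α₂ : ℂ → V` holomorphic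
on `D`; `φ₀ : ℂ`; per index the `Z`-letters `δ i, r i : V →L V₀ i`, `π i : V₀ i →L X` with `δ i ∘ ι = r i ∘ ι ∘ T i`, `π i ∘ r i ∘ ι = 1`, `δ i ∘ (1 − P)` compact.  THEN there are
`A : ℂ → (X × ℂ →L (I → X) × V × X')` and `c : ℂ → (I → X) × V × X'`, BOTH HOLOMORPHIC on `D`, whose solutions are exactly the pairs `(ψ, b)` with `∀ i, T i ψ = ĥ i z • ψ`,
`P (ι ψ) = φ₀ • α₁ z + b • α₂ z`, `Q ψ = 0`, and which satisfy the `hfin` clause of ★ `exists_meromorphic_solution` at every point of `D` (★ G-b `locallyFiniteType_of_index` at an index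
with `ĥ i z₀ ≠ 0`).  (`A z := A₀ − Σ_i ĥ i z • B_i − J₂ ∘ (snd ⊗ α₂ z)`, `c z := J₂(φ₀ • α₁ z)`.) [cite: BernsteinLapid2019, §4 pp. 9–10] -/
theorem exists_xSystem {I : Type*} [Fintype I] {X V X' : Type*} [NormedAddCommGroup X] [NormedSpace ℂ X] [NormedAddCommGroup V] [InnerProductSpace ℂ V] [CompleteSpace V]
    [NormedAddCommGroup X'] [NormedSpace ℂ X'] {V₀ : I → Type*} [∀ i, NormedAddCommGroup (V₀ i)] [∀ i, NormedSpace ℂ (V₀ i)] {D : Set ℂ} (hD : IsOpen D) (T : I → X →L[ℂ] X)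
    {ĥ : I → ℂ → ℂ} (hĥ : ∀ i, DifferentiableOn ℂ (ĥ i) D) (hcov : ∀ z ∈ D, ∃ i, ĥ i z ≠ 0) (ι : X →L[ℂ] V) (P : V →L[ℂ] V) (Q : X →L[ℂ] X') {α₁ α₂ : ℂ → V}
    (hα₁ : DifferentiableOn ℂ α₁ D) (hα₂ : DifferentiableOn ℂ α₂ D) (φ₀ : ℂ) (δ r : ∀ i, V →L[ℂ] V₀ i) (π : ∀ i, V₀ i →L[ℂ] X) (hδι : ∀ i, δ i ∘L ι = r i ∘L ι ∘L T i)
    (hπ : ∀ i, π i ∘L r i ∘L ι = ContinuousLinearMap.id ℂ X) (hK : ∀ i, IsCompactOperator (δ i ∘L ((1 : V →L[ℂ] V) - P))) :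
    ∃ (A : ℂ → (X × ℂ) →L[ℂ] (I → X) × (V × X')) (c : ℂ → (I → X) × (V × X')), DifferentiableOn ℂ A D ∧ DifferentiableOn ℂ c D ∧
      (∀ (z : ℂ) (ψ : X) (b : ℂ), A z (ψ, b) = c z ↔ (∀ i, T i ψ = ĥ i z • ψ) ∧ P (ι ψ) = φ₀ • α₁ z + b • α₂ z ∧ Q ψ = 0) ∧
      ∀ z₀ ∈ D, ∃ W ∈ 𝓝 z₀, ∃ n : ℕ, ∃ e : Fin n → ℂ → X × ℂ, (∀ j, DifferentiableOn ℂ (e j) W) ∧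
        ∀ z ∈ W, ∀ x : X × ℂ, A z x = c z → x ∈ span ℂ (Set.range fun j => e j z) := by
  -- the three injections into `𝓦 := (I → X) × (V × X')`
  obtain ⟨J₁, hJ₁⟩ : ∃ J₁ : (I → X) →L[ℂ] (I → X) × (V × X'), J₁ = ContinuousLinearMap.inl ℂ (I → X) (V × X') := ⟨_, rfl⟩
  obtain ⟨J₂, hJ₂⟩ : ∃ J₂ : V →L[ℂ] (I → X) × (V × X'), J₂ = ContinuousLinearMap.inr ℂ (I → X) (V × X') ∘L ContinuousLinearMap.inl ℂ V X' := ⟨_, rfl⟩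
  obtain ⟨J₃, hJ₃⟩ : ∃ J₃ : X' →L[ℂ] (I → X) × (V × X'), J₃ = ContinuousLinearMap.inr ℂ (I → X) (V × X') ∘L ContinuousLinearMap.inr ℂ V X' := ⟨_, rfl⟩
  have hJ₁a : ∀ w, J₁ w = (w, (0, 0)) := fun w => by rw [hJ₁]; rfl
  have hJ₂a : ∀ v, J₂ v = (0, (v, 0)) := fun v => by rw [hJ₂]; rfl
  have hJ₃a : ∀ v, J₃ v = (0, (0, v)) := fun v => by rw [hJ₃]; rfl
  -- the constant part `A₀`, the coordinate operators `B i`, and the system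
  obtain ⟨A₀, hA₀⟩ : ∃ A₀ : (X × ℂ) →L[ℂ] (I → X) × (V × X'), A₀ = J₁ ∘L (ContinuousLinearMap.pi fun i => T i) ∘L ContinuousLinearMap.fst ℂ X ℂ +
      J₂ ∘L P ∘L ι ∘L ContinuousLinearMap.fst ℂ X ℂ + J₃ ∘L Q ∘L ContinuousLinearMap.fst ℂ X ℂ := ⟨_, rfl⟩
  obtain ⟨B, hB⟩ : ∃ B : I → (X × ℂ) →L[ℂ] (I → X) × (V × X'), B = fun i => J₁ ∘L ContinuousLinearMap.single ℂ (fun _ : I => X) i ∘L ContinuousLinearMap.fst ℂ X ℂ := ⟨_, rfl⟩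
  obtain ⟨A, hA⟩ : ∃ A : ℂ → (X × ℂ) →L[ℂ] (I → X) × (V × X'), A = fun z => A₀ - (∑ i, ĥ i z • B i) - J₂ ∘L (ContinuousLinearMap.snd ℂ X ℂ).smulRight (α₂ z) := ⟨_, rfl⟩
  obtain ⟨c, hc⟩ : ∃ c : ℂ → (I → X) × (V × X'), c = fun z => J₂ (φ₀ • α₁ z) := ⟨_, rfl⟩
  have hA₀a : ∀ (ψ : X) (b : ℂ), A₀ (ψ, b) = ((fun i => T i ψ), (P (ι ψ), Q ψ)) := fun ψ b => by
    rw [hA₀]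
    simp only [add_apply, ContinuousLinearMap.comp_apply, ContinuousLinearMap.coe_fst', ContinuousLinearMap.coe_pi', hJ₁a, hJ₂a, hJ₃a, Prod.mk_add_mk, add_zero, zero_add]
  have hBa : ∀ i (ψ : X) (b : ℂ), B i (ψ, b) = ((Pi.single i ψ : I → X), ((0 : V), (0 : X'))) := fun i ψ b => by
    rw [hB]
    simp only [ContinuousLinearMap.comp_apply, ContinuousLinearMap.coe_fst', hJ₁a]
    rfl
  have hsum : ∀ (z : ℂ) (ψ : X) (b : ℂ), (∑ i, ĥ i z • B i) (ψ, b) = ((fun j => ĥ j z • ψ), ((0 : V), (0 : X'))) := fun z ψ b => by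
    rw [sum_apply]
    simp only [smul_apply, hBa]
    ext j
    · rw [Prod.fst_sum]
      simp only [Prod.smul_fst]
      rw [sum_smul_single]
    · rw [Prod.snd_sum]; simp only [Prod.smul_snd, Prod.mk_zero_zero, smul_zero, Finset.sum_const_zero, Prod.fst_zero]
    · rw [Prod.snd_sum]; simp only [Prod.smul_snd, Prod.mk_zero_zero, smul_zero, Finset.sum_const_zero, Prod.snd_zero]
  have hAa : ∀ (z : ℂ) (ψ : X) (b : ℂ), A z (ψ, b) = ((fun i => T i ψ - ĥ i z • ψ), (P (ι ψ) - b • α₂ z, Q ψ)) := fun z ψ b => by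
    rw [hA]
    simp only [sub_apply, hA₀a, hsum, ContinuousLinearMap.comp_apply, ContinuousLinearMap.smulRight_apply, ContinuousLinearMap.coe_snd', hJ₂a, Prod.mk_sub_mk, sub_zero]
    rfl
  have hca : ∀ z, c z = (0, (φ₀ • α₁ z, 0)) := fun z => by rw [hc]; exact hJ₂a _
  -- solution characterisation
  have hchar : ∀ (z : ℂ) (ψ : X) (b : ℂ), A z (ψ, b) = c z ↔ (∀ i, T i ψ = ĥ i z • ψ) ∧ P (ι ψ) = φ₀ • α₁ z + b • α₂ z ∧ Q ψ = 0 := fun z ψ b => by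
    rw [hAa, hca, Prod.mk.injEq, Prod.mk.injEq]
    constructor
    · rintro ⟨h1, h2, h3⟩
      exact ⟨fun i => sub_eq_zero.1 (by simpa using congrFun h1 i), sub_eq_iff_eq_add.1 h2, h3⟩
    · rintro ⟨h1, h2, h3⟩
      exact ⟨funext fun i => by simpa [sub_eq_zero] using h1 i, sub_eq_iff_eq_add.2 h2, h3⟩
  refine ⟨A, c, ?_, ?_, hchar, fun z₀ hz₀ => ?_⟩
  · -- `A` is holomorphic on `D`
    have hsR : DifferentiableOn ℂ (fun z => (ContinuousLinearMap.snd ℂ X ℂ).smulRight (α₂ z)) D := by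
      have h := (ContinuousLinearMap.smulRightL ℂ (X × ℂ) V (ContinuousLinearMap.snd ℂ X ℂ)).differentiable.comp_differentiableOn hα₂
      refine h.congr fun z _ => ContinuousLinearMap.ext fun x => ?_
      simp only [Function.comp_apply, ContinuousLinearMap.smulRightL_apply_apply, ContinuousLinearMap.smulRight_apply]
    rw [hA]
    exact ((differentiableOn_const A₀).sub (DifferentiableOn.fun_sum fun i _ => (hĥ i).smul (differentiableOn_const (B i)))).sub ((differentiableOn_const J₂).clm_comp hsR)
  · -- `c` is holomorphic on `D`
    rw [hc]
    exact J₂.differentiable.comp_differentiableOn (hα₁.const_smul φ₀)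
  · -- `hfin` at `z₀`: ★ G-b at an index `i` with `ĥ i z₀ ≠ 0`
    obtain ⟨i, hi⟩ := hcov z₀ hz₀
    exact locallyFiniteType_of_index hD hz₀ (T i) (hĥ i) hi ι P hα₁ hα₂ φ₀ (δ i) (r i) (π i) (hδι i) (hπ i) (hK i)
      (fun z _ x hx => ((hchar z x.1 x.2).1 hx).1 i) (fun z _ x hx => ((hchar z x.1 x.2).1 hx).2.1)

/-! ## §3 Bookkeeping for `hunq`: the `b`-component is determined by `ψ` -/

/-- If `α₂(z) ≠ 0`, the coefficient `b` in `P(ιψ) = φ₀α₁(z) + bα₂(z)` is determined by `ψ`. [folklore] -/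
theorem xSystem_b_unique {V : Type*} [AddCommGroup V] [Module ℂ V] {p a α : V} (hα : α ≠ 0) {b b' : ℂ} (h : p = a + b • α) (h' : p = a + b' • α) : b = b' := by
  have h1 : b • α = b' • α := add_left_cancel (h.symm.trans h')
  exact smul_left_injective ℂ hα h1

/-- **`hunq` FROM UNIQUENESS OF `ψ`**: if at `z` every solution `(ψ, b)` of the packaged system has `ψ = ψ₀` (★ P6), if `(ψ₀, b₀)` is a solution (★ P7) and `α₂(z) ≠ 0`, then the solution
is unique: `∃! x, A z x = c z`. [cite: BernsteinLapid2019, §4 Claim 2] -/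
theorem xSystem_existsUnique_of {I : Type*} {X V X' 𝓦 : Type*} [NormedAddCommGroup X] [NormedSpace ℂ X] [NormedAddCommGroup V] [NormedSpace ℂ V] [NormedAddCommGroup X']
    [NormedSpace ℂ X'] [NormedAddCommGroup 𝓦] [NormedSpace ℂ 𝓦] {A : ℂ → (X × ℂ) →L[ℂ] 𝓦} {c : ℂ → 𝓦} {T : I → X →L[ℂ] X} {ĥ : I → ℂ → ℂ} {ι : X →L[ℂ] V} {P : V →L[ℂ] V}
    {Q : X →L[ℂ] X'} {α₁ α₂ : ℂ → V} {φ₀ : ℂ}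
    (hchar : ∀ (z : ℂ) (ψ : X) (b : ℂ), A z (ψ, b) = c z ↔ (∀ i, T i ψ = ĥ i z • ψ) ∧ P (ι ψ) = φ₀ • α₁ z + b • α₂ z ∧ Q ψ = 0) {z : ℂ} (hα : α₂ z ≠ 0)
    {ψ₀ : X} {b₀ : ℂ} (hsol : A z (ψ₀, b₀) = c z) (hψ : ∀ (ψ : X) (b : ℂ), A z (ψ, b) = c z → ψ = ψ₀) : ∃! x : X × ℂ, A z x = c z := by
  refine ⟨(ψ₀, b₀), hsol, fun x hx => ?_⟩
  have hψx : x.1 = ψ₀ := hψ x.1 x.2 hx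
  have hb : x.2 = b₀ := by
    have h1 := ((hchar z x.1 x.2).1 hx).2.1
    have h0 := ((hchar z ψ₀ b₀).1 hsol).2.1
    rw [hψx] at h1
    exact xSystem_b_unique hα h1 h0
  exact Prod.ext hψx hb

end Summit.HodgeConjecture.HodgeConjecture.Cruxes.H413.K2E1BLXSystemPackage

end
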